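import Summits.AtomisticToContinuum.BoseEinsteinCondensation.Theses.BECStronglyRayleigh
import Summits.AtomisticToContinuum.BoseEinsteinCondensation.Theorems.InsertionFieldDelocalisation.Negative.Toolkit
import Summits.AtomisticToContinuum.BoseEinsteinCondensation.Theorems.InsertionFieldDelocalisation.Negative.Tightness
import Summits.AtomisticToContinuum.BoseEinsteinCondensation.Theorems.InsertionFieldDelocalisation.Negative.PerronExistence
import HarnessLib

/-!
# Reduction of the crux to the normalised third moment: stub `stub_thirdMomentReduction` (S1) of
# line `log-insertion-infrared-bound` for crux `InsertionFieldDelocalisation`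
# (stmt-AtomisticToContinuum-9673)

Stub S1 of the skeleton `Cruxes/InsertionFieldDelocalisation` (line `log-insertion-infrared-bound`).
Conventions as in `Theorems/InsertionFieldDelocalisation/Negative/Toolkit.lean`: the two-particle
insertion field `r^T = field ψ T` (`|T| = N - 2`), `K1lhs r = Σr³/Σr + (Σr²)²/(Σr)²`,
`K1rhs r = Σr²`, and `InsertionFieldDelocalisationAt M` is the crux body at constant `M`.

Claim: if the `ω`-averaged arithmetic-mean normalised third moment
`A₃(T) = |Tᶜ|⁻¹ Σ_{x ∈ Tᶜ} (|Tᶜ| r^T_x / R_T)³` (`R_T = Σ_y r^T_y`) satisfies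
`Σ_T ‖r^T‖² A₃(T) ≤ K Σ_T ‖r^T‖²` for every admissible datum, then the crux holds with constant `8K`.

Proof (deterministic, no eigen-equation). Fix `T`, `r = r^T ≥ 0` (`field_nonneg`), `r = 0` on `T`
(`field_eq_zero_of_mem`), `n = |Tᶜ|`, `R = Σr`. If `R = 0` both sides vanish (`x/0 = 0`). Otherwise
`(Σr²)² ≤ R Σr³` (`sq_sum_sq_le_sum_mul_sum_cube`) gives `K1lhs r ≤ 2Σr³/R`, Cauchy–Schwarz on the
support gives `R² ≤ n Σr²`, and `Σ_{Tᶜ} (n r_x/R)³ = n³ Σr³/R³`; hence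
`L³ K1lhs r ≤ 2L³ n Σr² Σr³/R³ ≤ 8 n² Σr² Σr³/R³ = 8 ‖r‖² A₃(T)` as soon as `L³ ≤ 4n`, which follows
from `n = L³ - N + 2` and the half-filling restriction `2N ≤ L³`. Summing over `T` and applying the
hypothesis concludes.
-/

noncomputable section

open scoped BigOperators
open Literature.MathematicalPhysics.QuantumLattice Literature.Probability.LatticeModels
open Summit.AtomisticToContinuum.BoseEinsteinCondensation.Theorems.InsertionFieldDelocalisation.Negative

set_option linter.dupNamespace false

namespace Summit.AtomisticToContinuum.BoseEinsteinCondensation.Cruxes.InsertionFieldDelocalisation.LogInsertionInfraredBound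

/-! ### The scalar inequality behind the reduction -/

/-- The scalar core of the reduction: with `S2 = Σr²`, `S3 = Σr³`, `R = Σr > 0`, `n > 0`,
Chebyshev `S2² ≤ R S3`, Cauchy–Schwarz `R² ≤ n S2` and `0 ≤ c ≤ 4n`,
`c (S3/R + S2²/R²) ≤ 8 S2 (n³ S3 / R³) / n`. [folklore] -/
theorem s1red_alg (c n R S2 S3 : ℝ) (hc0 : 0 ≤ c) (hc : c ≤ 4 * n) (hn : 0 < n) (hR : 0 < R)
    (hS2 : 0 ≤ S2) (hS3 : 0 ≤ S3) (hcheb : S2 ^ 2 ≤ R * S3) (hCS : R ^ 2 ≤ n * S2) :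
    c * (S3 / R + S2 ^ 2 / R ^ 2) ≤ 8 * (S2 * ((n ^ 3 / R ^ 3 * S3) / n)) := by
  have h1 : S2 ^ 2 / R ^ 2 ≤ S3 / R := by
    rw [div_le_div_iff₀ (by positivity) hR]
    calc S2 ^ 2 * R ≤ R * S3 * R := mul_le_mul_of_nonneg_right hcheb hR.le
      _ = S3 * R ^ 2 := by ring
  have h2 : 2 * c * n ≤ 8 * n ^ 2 := by nlinarith [mul_le_mul_of_nonneg_left hc hn.le]
  have key : 2 * c * S3 * R ^ 2 ≤ 8 * n ^ 2 * S2 * S3 :=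
    calc 2 * c * S3 * R ^ 2 ≤ 2 * c * S3 * (n * S2) := mul_le_mul_of_nonneg_left hCS (by positivity)
      _ = 2 * c * n * (S2 * S3) := by ring
      _ ≤ 8 * n ^ 2 * (S2 * S3) := mul_le_mul_of_nonneg_right h2 (by positivity)
      _ = 8 * n ^ 2 * S2 * S3 := by ring
  calc c * (S3 / R + S2 ^ 2 / R ^ 2) ≤ c * (2 * (S3 / R)) :=
        mul_le_mul_of_nonneg_left (by linarith) hc0
    _ = 2 * c * S3 * R ^ 2 / R ^ 3 := by field_simp
    _ ≤ 8 * n ^ 2 * S2 * S3 / R ^ 3 := div_le_div_of_nonneg_right key (by positivity)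
    _ = 8 * (S2 * ((n ^ 3 / R ^ 3 * S3) / n)) := by field_simp

/-! ### The termwise inequality for a nonnegative field supported in `S` -/

/-- **Termwise reduction.** For a nonnegative vector `r` supported in `S` (`n = #S`) and
`0 ≤ c ≤ 4n`: `c · ‖r‖²Φ(r) ≤ 8 ‖r‖² · n⁻¹ Σ_{x ∈ S} (n r_x / Σr)³`
(both sides vanish when `r ≡ 0`, matching `x/0 = 0`). [folklore] -/
theorem s1red_termwise {ι : Type*} [Fintype ι] (r : ι → ℝ) (hr : ∀ i, 0 ≤ r i) (S : Finset ι)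
    (hS : ∀ i, i ∉ S → r i = 0) (c : ℝ) (hc0 : 0 ≤ c) (hc : c ≤ 4 * (S.card : ℝ)) :
    c * K1lhs r ≤
      8 * (K1rhs r * ((∑ x ∈ S, ((S.card : ℝ) * r x / ∑ y, r y) ^ 3) / (S.card : ℝ))) := by
  have hsum_eq : ∀ f : ι → ℝ, (∀ i, i ∉ S → f i = 0) → ∑ i, f i = ∑ i ∈ S, f i := by
    intro f hf
    rw [← Finset.sum_subset (Finset.subset_univ S)]
    intro i _ hi
    exact hf i hi
  by_cases hR : ∑ i, r i = 0
  · -- `r ≡ 0`: both sides vanish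
    have h0 : ∀ i, r i = 0 := fun i =>
      (Finset.sum_eq_zero_iff_of_nonneg fun j _ => hr j).mp hR i (Finset.mem_univ i)
    simp [K1rhs, K1lhs, h0]
  have hRpos : 0 < ∑ i, r i := lt_of_le_of_ne (Finset.sum_nonneg fun i _ => hr i) (Ne.symm hR)
  have hS2 : 0 ≤ ∑ i, r i ^ 2 := Finset.sum_nonneg fun i _ => sq_nonneg (r i)
  have hS3 : 0 ≤ ∑ i, r i ^ 3 := Finset.sum_nonneg fun i _ => pow_nonneg (hr i) 3
  have hcheb := sq_sum_sq_le_sum_mul_sum_cube r hr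
  -- Cauchy–Schwarz on the support: `(Σr)² ≤ #S · Σr²`
  have hCS : (∑ i, r i) ^ 2 ≤ (S.card : ℝ) * ∑ i, r i ^ 2 := by
    rw [hsum_eq r hS, hsum_eq (fun i => r i ^ 2) fun i hi => by rw [hS i hi]; ring]
    exact sq_sum_le_card_mul_sum_sq
  have hn : (0 : ℝ) < S.card := by
    have h := (pow_pos hRpos 2).trans_le hCS
    by_contra hle
    push Not at hle
    have : (S.card : ℝ) * ∑ i, r i ^ 2 ≤ 0 := mul_nonpos_of_nonpos_of_nonneg hle hS2
    linarith
  -- pull the constants out of the normalised third moment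
  have hsumS : ∑ x ∈ S, ((S.card : ℝ) * r x / ∑ y, r y) ^ 3 =
      (S.card : ℝ) ^ 3 / (∑ y, r y) ^ 3 * ∑ x, r x ^ 3 := by
    rw [← hsum_eq (fun x => ((S.card : ℝ) * r x / ∑ y, r y) ^ 3) fun i hi => by
      rw [hS i hi]; simp, Finset.mul_sum]
    exact Finset.sum_congr rfl fun x _ => by ring
  rw [K1lhs, K1rhs, hsumS]
  exact s1red_alg c _ _ _ _ hc0 hc hn hRpos hS2 hS3 hcheb hCS

/-! ### The stub -/

/-- **S1 · `stub_thirdMomentReduction`.** Reduction of the crux to the `ω`-averaged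
arithmetic-mean normalised third moment of the insertion field, constant `8K`: termwise
`L³·K1lhs r ≤ 2·‖r‖²·L⁶Σr³/R³` (Cauchy–Schwarz + Chebyshev's sum inequality for `r ≥ 0`,
`x/0 = 0` consistent) and `L⁶Σr³/R³ = (L³/|Tᶜ|)²·A₃(T) ≤ 4A₃(T)` (`r^T = 0` on `T`,
`|Tᶜ| = L³ − N + 2 ≥ L³/2` from `2N ≤ L³`). [folklore] -/
theorem stub_thirdMomentReduction :
    ∀ K : ℝ,
      (∀ (L : ℕ) [NeZero L], 2 ≤ L → ∀ N : ℕ, 2 ≤ N → 2 * N ≤ L ^ 3 →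
        ∀ ψ : TensorIndex (TorusSite 3 L) 2 → ℂ,
          ψ ∈ spinZSector 1 ((N : ℝ) - (L : ℝ) ^ 3 / 2) → ψ ≠ 0 →
          (xyTorus 3 L 1).mulVec ψ =
            ((lowestEnergyInSector 1 (xyTorus 3 L 1) ((N : ℝ) - (L : ℝ) ^ 3 / 2) : ℝ) : ℂ) • ψ →
          (∀ σ, 0 ≤ (ψ σ).re ∧ (ψ σ).im = 0) →
          ∑ T ∈ (Finset.univ : Finset (TorusSite 3 L)).powersetCard (N - 2),
              K1rhs (field ψ T) *
                ((∑ x ∈ Tᶜ, ((Tᶜ.card : ℝ) * field ψ T x / ∑ y, field ψ T y) ^ 3) / (Tᶜ.card : ℝ)) ≤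
            K * ∑ T ∈ (Finset.univ : Finset (TorusSite 3 L)).powersetCard (N - 2), K1rhs (field ψ T)) →
      InsertionFieldDelocalisationAt (8 * K) := by
  intro K hK L _ hL N hN hNL ψ hsec hne heig hnn
  have h := hK L hL N hN hNL ψ hsec hne heig hnn
  rw [K1Ineq]
  -- termwise bound, `T` by `T`
  have hterm : ∀ T ∈ (Finset.univ : Finset (TorusSite 3 L)).powersetCard (N - 2),
      (L : ℝ) ^ 3 * K1lhs (field ψ T) ≤
        8 * (K1rhs (field ψ T) *
          ((∑ x ∈ Tᶜ, ((Tᶜ.card : ℝ) * field ψ T x / ∑ y, field ψ T y) ^ 3) / (Tᶜ.card : ℝ))) := by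
    intro T hT
    refine s1red_termwise (field ψ T) (field_nonneg ψ (fun σ => (hnn σ).1) T) Tᶜ
      (fun x hx => field_eq_zero_of_mem ψ T (by simpa using hx)) ((L : ℝ) ^ 3) (by positivity) ?_
    -- `L³ ≤ 4 |Tᶜ|` from `|Tᶜ| = L³ - (N - 2)` and `2N ≤ L³`
    have hTc : T.card = N - 2 := (Finset.mem_powersetCard.mp hT).2
    have hnat : L ^ 3 ≤ 4 * Tᶜ.card := by
      rw [Finset.card_compl, hTc,
        Summit.AtomisticToContinuum.BoseEinsteinCondensation.Theorems.InsertionFieldDelocalisation.Negative.card_torusSite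
          3 L]
      omega
    exact_mod_cast hnat
  calc (L : ℝ) ^ 3 * ∑ T ∈ (Finset.univ : Finset (TorusSite 3 L)).powersetCard (N - 2),
        K1lhs (field ψ T)
      = ∑ T ∈ (Finset.univ : Finset (TorusSite 3 L)).powersetCard (N - 2),
          (L : ℝ) ^ 3 * K1lhs (field ψ T) := Finset.mul_sum _ _ _
    _ ≤ ∑ T ∈ (Finset.univ : Finset (TorusSite 3 L)).powersetCard (N - 2),
          8 * (K1rhs (field ψ T) *
            ((∑ x ∈ Tᶜ, ((Tᶜ.card : ℝ) * field ψ T x / ∑ y, field ψ T y) ^ 3) / (Tᶜ.card : ℝ))) :=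
        Finset.sum_le_sum hterm
    _ = 8 * ∑ T ∈ (Finset.univ : Finset (TorusSite 3 L)).powersetCard (N - 2),
          K1rhs (field ψ T) *
            ((∑ x ∈ Tᶜ, ((Tᶜ.card : ℝ) * field ψ T x / ∑ y, field ψ T y) ^ 3) / (Tᶜ.card : ℝ)) :=
        (Finset.mul_sum _ _ _).symm
    _ ≤ 8 * (K * ∑ T ∈ (Finset.univ : Finset (TorusSite 3 L)).powersetCard (N - 2),
          K1rhs (field ψ T)) := mul_le_mul_of_nonneg_left h (by norm_num)
    _ = 8 * K * ∑ T ∈ (Finset.univ : Finset (TorusSite 3 L)).powersetCard (N - 2),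
          K1rhs (field ψ T) := (mul_assoc _ _ _).symm

end Summit.AtomisticToContinuum.BoseEinsteinCondensation.Cruxes.InsertionFieldDelocalisation.LogInsertionInfraredBound

end
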